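import Summits.ValiantsHypothesis.ValiantsHypothesis.Theorems.FifoMatchingNNDivisionHardExposedFibreRung

/-!
# FACE-BLIND / GENERATOR form of the located read on the zonotope chapter of COR-VIRTUAL (crux `NNDivisionHard`, stmt-ValiantsHypothesis-21181) — part 1/5 — §1–§10: the typed statements (class E♯ / Z, capture = refinement, the zonotope residual of record)

Theorems-side port (val-port-1 g3, presser; desk RULING #357 (A); declaration texts VERBATIM) of val-idea-41 g3's crux workfile
`Cruxes/NNDivisionHard/FaceBlind.lean` REV 7 @025cc0a9aa76 (sha16 588eb2e00eeb6290, 1599 l.; critic of record val-idea-crit-9 g2 VERDICT #43: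
VERIFIED, KEEP §G(4)+(3), axioms standard), split by the 400-line cap into five chained modules `…FaceBlind` (§1–§10: typed statements,
`captureIffRefines`, `classZReduction`, `zonoEnemy_covers`) → `…FaceBlindRung` (§11: `zonoGenBlindAtDecided_holds`) → `…FaceBlindFewZones`
(§12: `fewZonesLaw_oneBlock`) → `…FaceBlindCliqueZone` (§13: `covZonoHard_cliqueZone`) → `…FaceBlindCount` (§14: `covZonoHardClique_holds`).
DEDUP (desk: import, do not copy): the workfile's verbatim pastes of landed declarations are REPLACED by imports — `Jdir` :=
`ExposedFibre.Jdir` (✓ `…ExposedFibreRung`), `exists_large_avoid` / `exists_generic_comb` := `LowDim.*` (✓ `…LowDimFace`), `chi` / `uVec` / `uPush` /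
`sum_uVec_chi` / `negRankOne_dot_corVec` / `sum_uPush_chi` := `ConePricing.*` (✓ `…ConePricing`); the pasted one-cut-rung lemmas of val-idea-40
(`admissible_blockDir`, `Admissible.dot_eq_zero_iff/dot_le/face_eq`, `exposedFibreRung_holds`, `exposedFibreDecided_holds`) keep their FOLDED
statements here and are PROVED BY CITATION of the δ-unfolded landed theorems `ExposedFibre.*` (✓ p674xxx `…ExposedFibreRung`, val-port-4 g3 /
val-idea-40 g4).  Namespace `…Theorems.FifoMatching.FaceBlind` (workfile: `…Cruxes.NNDivisionHard.FaceBlind41`).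

* VERBATIM copies of the line's `BlockConstSymGen`, `lvl`, `BlockBlind` (`Lines/virtual_passenger.lean`; crux workfiles are cited, not imported); `Jdir` is the
  landed `ExposedFibre.Jdir`.
* PROVED: `faceBlockBlind_of_blockBlind`, `twoClassKernelCutSigned`, `captureIffRefines`, `zonoGenBlindAt_of_not_covers`, `lt_of_not_covers`, `classZReduction`
  (P-R1d: the reduction glue BY NAME), `zonoEnemy_covers`; typed-not-asserted: `FewGeneratorZonotopeLaw`, `ZonoGenBlindAtDecided`, `FewZonesLawAt`, `ClassZ`,
  `CovZonoHard`, `ZonoResidualSpec`, `ZonoResidualLaw` (E5).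

HONEST LABEL: helper rows for an OPEN crux (21181 `NNDivisionHard` OPEN; `CovZonoHard` OPEN for general zonotopal passengers); nothing here is a
summit statement; VP ≠ VNP is NOT proved.
-/

set_option autoImplicit false
set_option linter.dupNamespace false

noncomputable section
open Matrix Finset
open scoped Pointwise

namespace Summit.ValiantsHypothesis.ValiantsHypothesis.Theorems.FifoMatching.FaceBlind

open Literature.Barriers.PneNP (HasEFOfSize)
open Literature.Combinatorics.Optimization (corPolytopeGraph corVec)
open Summit.ValiantsHypothesis.ValiantsHypothesis.Theorems.FifoMatching.ExposedFibre (Jdir)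

variable {n m : ℕ}

/-- (line, verbatim) symmetric and `β`-block-constant. -/
def BlockConstSymGen (β : Fin n → Fin m) (g : Fin n × Fin n → ℝ) : Prop :=
  (∀ p q, g (p, q) = g (q, p)) ∧ ∀ p q p' q', β p = β p' → β q = β q' → g (p, q) = g (p', q')

-- `Jdir` (the all-ones direction) is the LANDED `ExposedFibre.Jdir` (✓ `…ExposedFibreRung`, same text as the line decl) — opened above.

/-- (line, verbatim) the block level `⌊√h⌋ − 2`. -/
def lvl (h : ℕ) : ℕ := Nat.sqrt h - 2

/-- (line, verbatim) CLASS E — block-blind in the VERTEX-DIFFERENCE proxy: ALL pairwise differences are tested. -/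
def BlockBlind (h : ℕ) {J : Type} (q : J → (Fin h × Fin h → ℝ)) : Prop :=
  ∃ (β : Fin h → Fin (lvl h + 1)) (ρ : Fin (lvl h + 1) → Fin h), (∀ t, β (ρ t) = t) ∧
    ∀ j j', BlockConstSymGen β (q j - q j') → ∃ α : ℝ, q j - q j' = α • Jdir h

/-- ITERATED-ARGMAX index sets of a finite family `q` — exactly the sets the engine `blockRead_iterate` visits (each step filters the
current set to the maximisers of a linear functional; stated extensionally, no decidability needed). -/
inductive IterArgmax {J : Type} [Fintype J] (q : J → (Fin n × Fin n → ℝ)) : Finset J → Prop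
  | univ : IterArgmax q Finset.univ
  | step {Jk J' : Finset J} (φ : Fin n × Fin n → ℝ) (c : ℝ)
      (hmax : ∀ i ∈ Jk, φ ⬝ᵥ q i ≤ c) (hJ' : ∀ i, i ∈ J' ↔ i ∈ Jk ∧ φ ⬝ᵥ q i = c) (hne : J'.Nonempty) :
      IterArgmax q Jk → IterArgmax q J'

/-- ★ CLASS E♯ — FACE-BLOCK-BLIND (the sharp, face form of E): for some coarse block map `β` with a section, on every iterated-argmax
index set whose pairwise differences are all symmetric `β`-block-constant, those differences are multiples of `J`.  This is EXACTLY the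
hypothesis the proof of `locatedFaceExposureRung_holds` consumes (it invokes the J-multiple hypothesis only on the terminal set `J'` of
`blockRead_iterate`).  E ⊆ E♯ (`faceBlockBlind_of_blockBlind`); E♯ ∖ E contains every unimodular-for-rank-ones parallelotope (Π*), for
which class E fails at every `β` while E♯ holds at an equipartition-avoiding `β`. -/
def FaceBlockBlind (h : ℕ) {J : Type} [Fintype J] (q : J → (Fin h × Fin h → ℝ)) : Prop :=
  ∃ (β : Fin h → Fin (lvl h + 1)) (ρ : Fin (lvl h + 1) → Fin h), (∀ t, β (ρ t) = t) ∧
    ∀ J' : Finset J, IterArgmax q J' →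
      (∀ j ∈ J', ∀ j' ∈ J', BlockConstSymGen β (q j - q j')) →
      ∀ j ∈ J', ∀ j' ∈ J', ∃ α : ℝ, q j - q j' = α • Jdir h

/-- E ⊆ E♯ (trivial: E tests all pairs). -/
theorem faceBlockBlind_of_blockBlind (h : ℕ) {J : Type} [Fintype J] (q : J → (Fin h × Fin h → ℝ))
    (hE : BlockBlind h q) : FaceBlockBlind h q := by
  obtain ⟨β, ρ, hρ, hJ⟩ := hE
  exact ⟨β, ρ, hρ, fun J' _ hbc j hj j' hj' => hJ j j' (hbc j hj j' hj')⟩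

/-- ★ THE SHARP RUNG (prover food P3, ≈ 60 lines on top of the landed file): `locatedFaceExposureRung_holds` with the J-multiple
hypothesis asked only on iterated-argmax sets.  Proof plan: add `(hI : IterArgmax q Jk)` to the hypotheses and `IterArgmax q J'` to the
conclusion of `blockRead_iterate` (the `succ` step IS an argmax filter: `IterArgmax.step φ (φ ⬝ᵥ q j₀) …`); step 0 of the rung is
`IterArgmax.step B (B ⬝ᵥ q j₀) … IterArgmax.univ`; the rest of the proof is unchanged. -/
def FaceLocatedExposureRung : Prop :=
  ∀ (n m : ℕ) (β : Fin n → Fin m) (ρ : Fin m → Fin n), (∀ t, β (ρ t) = t) →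
    ∀ (K : ℕ) (q : Fin (K + 1) → (Fin n × Fin n → ℝ)) (r : ℕ),
      (∀ J' : Finset (Fin (K + 1)), IterArgmax q J' →
        (∀ j ∈ J', ∀ j' ∈ J', BlockConstSymGen β (q j - q j')) →
        ∀ j ∈ J', ∀ j' ∈ J', ∃ α : ℝ, q j - q j' = α • Jdir n) →
      HasEFOfSize (corPolytopeGraph (⊤ : SimpleGraph (Fin n)) + convexHull ℝ (Set.range q)) r →
        ∃ q' : Fin 2 → (Fin m × Fin m → ℝ),
          HasEFOfSize (corPolytopeGraph (⊤ : SimpleGraph (Fin m)) + convexHull ℝ (Set.range q')) r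

/-- ★ CLASS E♯ IS DECIDED (statement; = `FaceLocatedExposureRung` ∘ PROP A at `K = 2`, as `blockBlind_three_halves_pow_le`). -/
def FaceBlockBlindDecided : Prop :=
  ∀ (h K : ℕ) (q : Fin (K + 1) → (Fin h × Fin h → ℝ)) (r : ℕ), FaceBlockBlind h q →
    HasEFOfSize (corPolytopeGraph (⊤ : SimpleGraph (Fin h)) + convexHull ℝ (Set.range q)) r →
      (3 / 2 : ℝ) ^ (lvl h) ≤ 2 * (r + 1)

/-! ## Zonotopal passengers: the read sees GENERATORS, not vertex differences -/

/-- the subset-sum (vertex) family of the zonotope `w + Σ_i [0,1]·gen i`, indexed by subsets of the generator index set. -/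
def subsetSum {M : ℕ} (gen : Fin M → (Fin n × Fin n → ℝ)) (w : Fin n × Fin n → ℝ) :
    Finset (Fin M) → (Fin n × Fin n → ℝ) :=
  fun S => w + ∑ i ∈ S, gen i

/-- ★ SUB-CUBE INVARIANT (statement; paper proof 5 lines: the maximisers of `φ` over the sub-cube `{S₀ ∪ T' : T' ⊆ T}` are
`{S₀ ∪ T₊ ∪ T'' : T'' ⊆ T⁰}`, `T₊ = {i ∈ T : φ·gen i > 0}`, `T⁰ = {i ∈ T : φ·gen i = 0}`): every iterated-argmax index set of a
subset-sum family is a sub-cube — so its pairwise differences include every single surviving generator `gen i`, `i ∈ T`. -/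
def SubcubeInvariant : Prop :=
  ∀ (n M : ℕ) (gen : Fin M → (Fin n × Fin n → ℝ)) (w : Fin n × Fin n → ℝ) (J' : Finset (Finset (Fin M))),
    IterArgmax (subsetSum gen w) J' →
      ∃ S₀ T : Finset (Fin M), Disjoint S₀ T ∧ ∀ S, S ∈ J' ↔ ∃ T' ⊆ T, S = S₀ ∪ T'

/-- ★ CLASS Z♭ — GENERATOR-BLIND ZONOTOPAL families (presentation-free in `q`: only the point SET matters): the hull of the family is a
zonotope `w + Σ_i [0,1]·gen i` (equality of HULLS, so vertex-presented zonotopes with dependent generators count) some coarse `β` of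
which sees no `β`-block-constant GENERATOR off `ℝJ`.  Contains: every parallelotope
`Π_G` (any basis `G` of `Sym_h`, `h ≥ 16`), Π*, Π♮, `Z_mix`, `Z_s`, every zonotope with `< C(h′,t)/m` generator directions off `ℝJ`
(by `EquipartitionAvoidance`, val-idea-38 `PairFace.lean` l.333, proof plan val-idea-40).  Z♭ ⊆ E♯ on the subset-sum presentation
(`SubcubeInvariant`), while Π* ∈ Z♭ ∖ E. -/
def ZonoGenBlind (h : ℕ) {J : Type} (q : J → (Fin h × Fin h → ℝ)) : Prop :=
  ∃ (β : Fin h → Fin (lvl h + 1)) (ρ : Fin (lvl h + 1) → Fin h), (∀ t, β (ρ t) = t) ∧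
    ∃ (M : ℕ) (gen : Fin M → (Fin h × Fin h → ℝ)) (w : Fin h × Fin h → ℝ),
      convexHull ℝ (Set.range q) = convexHull ℝ (Set.range (subsetSum gen w)) ∧
      ∀ i, BlockConstSymGen β (gen i) → ∃ α : ℝ, gen i = α • Jdir h

/-- ★ Z♭ IS DECIDED (statement; proof = `FaceLocatedExposureRung` on the subset-sum family `J = Finset (Fin M)` — the engine
`blockRead_iterate` is stated for an arbitrary index type — + `SubcubeInvariant` + PROP A at `K = 2`; `conv (range q)` is replaced by the
equal set `conv (range (subsetSum gen w))`). -/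
def ZonoGenBlindDecided : Prop :=
  ∀ (h K : ℕ) (q : Fin (K + 1) → (Fin h × Fin h → ℝ)) (r : ℕ), ZonoGenBlind h q →
    HasEFOfSize (corPolytopeGraph (⊤ : SimpleGraph (Fin h)) + convexHull ℝ (Set.range q)) r →
      (3 / 2 : ℝ) ^ (lvl h) ≤ 2 * (r + 1)

/-- ★ FEW-GENERATOR ZONOTOPE LAW = THE PARALLELOTOPE NO-GO (statement, UNBUDGETED; = `EquipartitionAvoidance` ∘ `ZonoGenBlindDecided`,
leftover indices `p ≥ m·t` merged into the last block; generators `∝ J` are harmless and simply counted): a zonotopal passenger with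
`M` generators, `M·m < C(m·t, t)`, `m = lvl h + 1`, `t = ⌊h/m⌋`, obeys the class-E rate.  Every BASIS of `Sym_h` has `M ≤ h(h+1)/2`, and
`h(h+1)/2 · m < C(m t, t)` for all `h ≥ 16` (`native_decide` instance below at `h = 16`): NO parallelotope is a member of the residual
core — the W5-R1 «parallelotope enemy» does not exist. -/
def FewGeneratorZonotopeLaw : Prop :=
  ∀ (h M : ℕ) (gen : Fin M → (Fin h × Fin h → ℝ)) (w : Fin h × Fin h → ℝ) (r : ℕ),
    M * (lvl h + 1) < Nat.choose ((lvl h + 1) * (h / (lvl h + 1))) (h / (lvl h + 1)) →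
    HasEFOfSize (corPolytopeGraph (⊤ : SimpleGraph (Fin h)) + convexHull ℝ (Set.range (subsetSum gen w))) r →
      (3 / 2 : ℝ) ^ (lvl h) ≤ 2 * (r + 1)

/-- the count at the first nontrivial level `h = 16` (`lvl 16 = 2`, `m = 3`, `t = 5`): `136 · 3 = 408 < C(15,5) = 3003`. -/
example : (16 * 17 / 2) * (lvl 16 + 1) < Nat.choose ((lvl 16 + 1) * (16 / (lvl 16 + 1))) (16 / (lvl 16 + 1)) := by
  native_decide

/-- … and at `h = 64` (`m = 7`, `t = 9`): `2080 · 7 = 14560 < C(63,9)`. -/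
example : (64 * 65 / 2) * (lvl 64 + 1) < Nat.choose ((lvl 64 + 1) * (64 / (lvl 64 + 1))) (64 / (lvl 64 + 1)) := by
  native_decide

/-! ## What a zonotopal test member of the residual must carry instead (card §(E3)): 2-class step kernels are CUT-SIGNED -/

/-- the single-edge cut row `δ_ij(y) = y_ii + y_jj − 2 y_ij` (the line's `cutDirG i j ⬝ᵥ y`, spelled out). -/
def cutVal (i j : Fin n) (y : Fin n × Fin n → ℝ) : ℝ := y (i, i) + y (j, j) - 2 * y (i, j)

/-- ★ (statement, one line of algebra) a 2-CLASS STEP KERNEL `g = x·P_A + y·P_{Aᶜ} + z·J` takes the SAME value `x + y` on every edge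
cut crossing `A` and `0` on every other edge: it is cut-signed, so a zonotope all of whose `β`-capturing generators are 2-class reads, at
level `m`, to a CUT-DOMINANT (class K) passenger — decided modulo KMR.  Enemy capturing generators need ≥ 3 clone classes with quotient
pair values `x_aa + x_bb − 2 x_ab` of both signs. -/
def TwoClassKernelCutSigned : Prop :=
  ∀ (n : ℕ) (A : Finset (Fin n)) (x y z : ℝ) (i j : Fin n), i ≠ j →
    cutVal i j (fun pq => (if pq.1 ∈ A ∧ pq.2 ∈ A then x else 0) + (if pq.1 ∉ A ∧ pq.2 ∉ A then y else 0) + z) =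
      if (i ∈ A ↔ j ∈ A) then 0 else x + y

/-- `TwoClassKernelCutSigned` holds: 2-class step kernels are cut-signed. -/
theorem twoClassKernelCutSigned : TwoClassKernelCutSigned := by
  intro n A x y z i j hij
  unfold cutVal
  by_cases hi : i ∈ A <;> by_cases hj : j ∈ A <;> simp [hi, hj] <;> ring

/-! ## (E4) Capture = refinement · the level-`m′` few-zones law · the COR-free reduction of the zonotope chapter (card rev 1.7) -/

/-- rows `p` and `p'` of `g` coincide. -/
def SameRow (g : Fin n × Fin n → ℝ) (p p' : Fin n) : Prop := ∀ q, g (p, q) = g (p', q)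

/-- ★ CAPTURE = REFINEMENT: a symmetric `g` is `β`-block-constant iff `β` refines the ROW PARTITION of `g` (rows equal within blocks).
So «generator `g` is captured by `β`» is the lattice statement `blocks(β) ≤ 𝒜(g)`, and a zone family is β-covering iff its row partitions
cover level `m′` of the partition lattice from above. -/
def CaptureIffRefines : Prop :=
  ∀ (n m : ℕ) (β : Fin n → Fin m) (g : Fin n × Fin n → ℝ), (∀ p q, g (p, q) = g (q, p)) →
    (BlockConstSymGen β g ↔ ∀ p p', β p = β p' → SameRow g p p')

/-- `CaptureIffRefines` holds: a block map captures a zone iff it refines the zone's row partition. -/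
theorem captureIffRefines : CaptureIffRefines := by
  intro n m β g hsym
  constructor
  · rintro ⟨-, hbc⟩ p p' hpp' q
    exact hbc p q p' q hpp' rfl
  · intro H
    refine ⟨hsym, fun p q p' q' hp hq => ?_⟩
    rw [H p p' hp q, hsym p' q, H q q' hq p', hsym q' p']

/-- the zone family `gen` COVERS level `m'`: every surjection `β : [h] ↠ [m']` captures some zone off `ℝJ`. -/
def Covers (h m' : ℕ) {M : ℕ} (gen : Fin M → (Fin h × Fin h → ℝ)) : Prop :=
  ∀ β : Fin h → Fin m', Function.Surjective β →
    ∃ i, BlockConstSymGen β (gen i) ∧ ¬ ∃ α : ℝ, gen i = α • Jdir h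

/-- level-parametrised Z♭: generator-blind at SOME surjection onto `m'` blocks (`m' = lvl h + 1` is `ZonoGenBlind`). -/
def ZonoGenBlindAt (h m' : ℕ) {J : Type} (q : J → (Fin h × Fin h → ℝ)) : Prop :=
  ∃ (β : Fin h → Fin m') (ρ : Fin m' → Fin h), (∀ t, β (ρ t) = t) ∧
    ∃ (M : ℕ) (gen : Fin M → (Fin h × Fin h → ℝ)) (w : Fin h × Fin h → ℝ),
      convexHull ℝ (Set.range q) = convexHull ℝ (Set.range (subsetSum gen w)) ∧
      ∀ i, BlockConstSymGen β (gen i) → ∃ α : ℝ, gen i = α • Jdir h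

/-- DICHOTOMY GLUE (checked): a zonotopal family that does not cover level `m'` is generator-blind at level `m'`. -/
theorem zonoGenBlindAt_of_not_covers (h m' : ℕ) {J : Type} (q : J → (Fin h × Fin h → ℝ)) {M : ℕ}
    (gen : Fin M → (Fin h × Fin h → ℝ)) (w : Fin h × Fin h → ℝ)
    (hhull : convexHull ℝ (Set.range q) = convexHull ℝ (Set.range (subsetSum gen w)))
    (hnc : ¬ Covers h m' gen) : ZonoGenBlindAt h m' q := by
  unfold Covers at hnc
  push Not at hnc
  obtain ⟨β, hβ, hblind⟩ := hnc
  exact ⟨β, Function.surjInv hβ, fun t => Function.surjInv_eq hβ t, M, gen, w, hhull, hblind⟩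

/-- ★ Z♭ AT LEVEL `m'` IS DECIDED at rate `(3/2)^(m'-1)` (statement; same proof as `ZonoGenBlindDecided` with `β : [h] ↠ [m']`; the route
needs only `m' = m_min(n,c) ≈ 1.71·(log₂ n + c)^c + 3`). -/
def ZonoGenBlindAtDecided : Prop :=
  ∀ (h m' K : ℕ) (q : Fin (K + 1) → (Fin h × Fin h → ℝ)) (r : ℕ), ZonoGenBlindAt h m' q →
    HasEFOfSize (corPolytopeGraph (⊤ : SimpleGraph (Fin h)) + convexHull ℝ (Set.range q)) r →
      (3 / 2 : ℝ) ^ (m' - 1) ≤ 2 * (r + 1)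

/-- ★ FEW-ZONES LAW AT LEVEL `m'` (statement, UNBUDGETED; = `EquipartitionAvoidance` at `t = ⌊h/m'⌋` ∘ `ZonoGenBlindAtDecided`): fewer than
`C(m'·t, t)/m'` zones ⇒ decided at rate `(3/2)^(m'-1)`.  At `m' = m_min = polylog h` the threshold is `2^{(h/m')·log₂(e m')(1−o(1))} =
2^{h^{1−o(1)}}`: EVERY zonotopal passenger with at most `2^{h^{1−ε}}` zones is decided. -/
def FewZonesLawAt : Prop :=
  ∀ (h m' M : ℕ) (gen : Fin M → (Fin h × Fin h → ℝ)) (w : Fin h × Fin h → ℝ) (r : ℕ), 2 ≤ h / m' →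
    M * m' < Nat.choose (m' * (h / m')) (h / m') →
    HasEFOfSize (corPolytopeGraph (⊤ : SimpleGraph (Fin h)) + convexHull ℝ (Set.range (subsetSum gen w))) r →
      (3 / 2 : ℝ) ^ (m' - 1) ≤ 2 * (r + 1)

/-- ★ CLASS Z (statement): every SYMMETRIC-zone zonotopal passenger obeys the law in the crux's shape — budget `r` on the passenger, conclusion
`2^{(log₂ h + C)^C} < r` once `COR(K_h) + Z` also fits in `r`. -/
def ClassZ : Prop :=
  ∀ C : ℕ, ∃ h₀ : ℕ, ∀ h ≥ h₀, ∀ (M : ℕ) (gen : Fin M → (Fin h × Fin h → ℝ)) (w : Fin h × Fin h → ℝ) (r : ℕ),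
    (∀ i p q, gen i (p, q) = gen i (q, p)) →
    HasEFOfSize (convexHull ℝ (Set.range (subsetSum gen w))) r →
    HasEFOfSize (corPolytopeGraph (⊤ : SimpleGraph (Fin h)) + convexHull ℝ (Set.range (subsetSum gen w))) r →
      2 ^ ((Nat.log 2 h + C) ^ C) < r

/-- ★★ `CovZonoHard` — the COR-FREE CONJECTURE the zonotope chapter reduces to: a zonotope in `Sym_h` whose zones' row partitions cover level
`m' = 2·(log₂ h + C)^C + 4` (≥ `m_min`) of the partition lattice is NOT budgeted: `xc > 2^{(log₂ h + C)^C}`.  No `COR`, no permanent, no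
circuit in the statement — an extension-complexity lower bound for an explicit, highly constrained class of zonotopes (≥ `2^{h^{1−o(1)}}` zones by
`FewZonesLawAt`'s count, not confined to few low-dimensional flats by the flat lemma of the card). -/
def CovZonoHard : Prop :=
  ∀ C : ℕ, ∃ h₀ : ℕ, ∀ h ≥ h₀, ∀ (M : ℕ) (gen : Fin M → (Fin h × Fin h → ℝ)) (w : Fin h × Fin h → ℝ) (r : ℕ),
    (∀ i p q, gen i (p, q) = gen i (q, p)) →
    Covers h (2 * (Nat.log 2 h + C) ^ C + 4) gen →
    HasEFOfSize (convexHull ℝ (Set.range (subsetSum gen w))) r → 2 ^ ((Nat.log 2 h + C) ^ C) < r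

/-- ★ THE REDUCTION (statement of the glue; proof = `zonoGenBlindAt_of_not_covers` + `ZonoGenBlindAtDecided` at `m' = 2(log₂ h + C)^C + 4` +
the arithmetic `(3/2)^{m'−1} > 2·2^{(log₂ h + C)^C} + 2`, eventually in `h`): the zonotope chapter of COR-MINKOWSKI is `CovZonoHard`. -/
def ClassZReduction : Prop := CovZonoHard → ZonoGenBlindAtDecided → ClassZ

/-! ## 9. P-R1d (crit-9 VERDICT #17): the reduction glue BY NAME, in kernel

The arithmetic: at `L = (log₂ h + C)^C ≥ 1` and reduction level `m' = 2L + 4`, the decided branch gives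
`(3/2)^{2L+3} = (27/8)·(9/4)^L ≤ 2(r+1)`, incompatible with `r ≤ 2^L`.  No threshold in `h` is needed on this branch. -/

/-- the level function `L` is at least `1`. -/
theorem one_le_L (h C : ℕ) : 1 ≤ (Nat.log 2 h + C) ^ C := by
  rcases Nat.eq_zero_or_pos C with rfl | hC
  · simp
  · exact Nat.one_le_pow _ _ (by omega)

/-- the decided (generator-blind) branch of the reduction: `¬ Covers` at level `2L + 4` forces `2^L < r` for the COR-sum. -/
theorem lt_of_not_covers (hDec : ZonoGenBlindAtDecided) (C h : ℕ) {M : ℕ} (gen : Fin M → (Fin h × Fin h → ℝ))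
    (w : Fin h × Fin h → ℝ) (r : ℕ) (hc : ¬ Covers h (2 * (Nat.log 2 h + C) ^ C + 4) gen)
    (hR : HasEFOfSize (corPolytopeGraph (⊤ : SimpleGraph (Fin h)) + convexHull ℝ (Set.range (subsetSum gen w))) r) :
    2 ^ ((Nat.log 2 h + C) ^ C) < r := by
  set L := (Nat.log 2 h + C) ^ C with hLdef
  have hblind : ZonoGenBlindAt h (2 * L + 4) (subsetSum gen w) :=
    zonoGenBlindAt_of_not_covers h (2 * L + 4) (subsetSum gen w) gen w rfl hc
  -- reindex the subset-sum family by `Fin (K + 1)`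
  obtain ⟨K, ⟨e⟩⟩ : ∃ K, Nonempty (Finset (Fin M) ≃ Fin (K + 1)) := by
    refine ⟨Fintype.card (Finset (Fin M)) - 1, ⟨(Fintype.equivFin _).trans (finCongr ?_)⟩⟩
    have : 0 < Fintype.card (Finset (Fin M)) := Fintype.card_pos
    omega
  have hq : Set.range (subsetSum gen w ∘ e.symm) = Set.range (subsetSum gen w) :=
    Function.Surjective.range_comp e.symm.surjective _
  have hblind' : ZonoGenBlindAt h (2 * L + 4) (subsetSum gen w ∘ e.symm) := by
    obtain ⟨β, ρ, hρ, M', gen', w', hhull, hbl⟩ := hblind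
    exact ⟨β, ρ, hρ, M', gen', w', by rw [hq]; exact hhull, hbl⟩
  have hR' : HasEFOfSize (corPolytopeGraph (⊤ : SimpleGraph (Fin h)) +
      convexHull ℝ (Set.range (subsetSum gen w ∘ e.symm))) r := by
    rw [hq]; exact hR
  have hdec := hDec h (2 * L + 4) K (subsetSum gen w ∘ e.symm) r hblind' hR'
  have hm : 2 * L + 4 - 1 = 2 * L + 3 := by omega
  rw [hm] at hdec
  have hL : 1 ≤ L := one_le_L h C
  have h1 : (2 : ℝ) ≤ 2 ^ L := by
    calc (2 : ℝ) = 2 ^ 1 := by norm_num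
      _ ≤ 2 ^ L := pow_le_pow_right₀ (by norm_num) hL
  have h2 : (2 : ℝ) ^ L ≤ (9 / 4) ^ L := pow_le_pow_left₀ (by norm_num) (by norm_num) L
  have key : (3 / 2 : ℝ) ^ (2 * L + 3) = (9 / 4) ^ L * (27 / 8) := by
    rw [pow_add, pow_mul]; norm_num
  rw [key] at hdec
  have hlt : (2 : ℝ) ^ L < r := by linarith
  exact_mod_cast hlt

/-- ★ P-R1d PAID: `ClassZ ⇐ CovZonoHard ∧ ZonoGenBlindAtDecided`, glue by name. -/
theorem classZReduction : ClassZReduction := by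
  intro hCov hDec C
  obtain ⟨h₁, hh₁⟩ := hCov C
  refine ⟨h₁, fun h hh M gen w r hsym hZ hR => ?_⟩
  by_cases hc : Covers h (2 * (Nat.log 2 h + C) ^ C + 4) gen
  · exact hh₁ h hh M gen w r hsym hc hZ
  · exact lt_of_not_covers hDec C h gen w r hc hR

/-! ## 10. (E5) THE ZONOTOPE RESIDUAL OF RECORD — one typed line (P-R2c, joint val-idea-41 g3 × val-idea-44 g0)

A zonotopal ENEMY at parameter `C` and height `h` is a symmetric-zone zonotope that is a budgeted passenger AND keeps the COR-sum within
budget.  The SPEC lists what the record forces on it: (Z1) COVERING at the reduction level (41 (E4), kernel below modulo the one-cut rung);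
(Z2) every captured non-`J` zone EDGE-SIGN-MIXED, hence indefinite (41 (E3)(c)/(E4.6): cut-signed captured zones read to class K; ±PSD
zones are 38's `PSDZonotopeRung`); (Z3) FAN-CHEAP (44 N13): every tangent cone at a subset-sum point has an EF of size `≤ r + 1`
(44 `TangentConeEF`, whose `tangentCone` is copied verbatim below; listed because it is the form in which cone pricing reads — and provably cannot refute — the enemy).  `Z_cor` meets
(Z1)(Z2)(Z3) on paper; whether it meets the budget clause is `CovZonoHard`'s first instance. -/

/-- verbatim copy of val-idea-44 g0's `ConePricing44.tangentCone` (that Cruxes module is not in the farm's build closure, so it is not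
importable here): the tangent (= feasible-directions) cone of `P` at `v`, `{t·(p − v) : t ≥ 0, p ∈ P}`. -/
def tangentCone {ι : Type} (P : Set (ι → ℝ)) (v : ι → ℝ) : Set (ι → ℝ) :=
  {x | ∃ t : ℝ, 0 ≤ t ∧ ∃ p ∈ P, x = t • (p - v)}

/-- a symmetric direction is EDGE-SIGN-MIXED: the cut functional `δ_{pq}·g = g_pp + g_qq − 2·g_pq` takes both strict signs. -/
def EdgeSignMixed {h : ℕ} (g : Fin h × Fin h → ℝ) : Prop :=
  (∃ p q : Fin h, p ≠ q ∧ 0 < cutVal p q g) ∧ (∃ p q : Fin h, p ≠ q ∧ cutVal p q g < 0)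

/-- a zonotopal ENEMY (budgeted counterexample candidate) at `(C, h)`. -/
def ZonoEnemy (C h : ℕ) {M : ℕ} (gen : Fin M → (Fin h × Fin h → ℝ)) (w : Fin h × Fin h → ℝ) (r : ℕ) : Prop :=
  (∀ i p q, gen i (p, q) = gen i (q, p)) ∧ r ≤ 2 ^ ((Nat.log 2 h + C) ^ C) ∧
    HasEFOfSize (convexHull ℝ (Set.range (subsetSum gen w))) r ∧
    HasEFOfSize (corPolytopeGraph (⊤ : SimpleGraph (Fin h)) + convexHull ℝ (Set.range (subsetSum gen w))) r

/-- (E5) the residual SPEC of record: (Z1) ∧ (Z2) ∧ (Z3). -/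
def ZonoResidualSpec (C h : ℕ) {M : ℕ} (gen : Fin M → (Fin h × Fin h → ℝ)) (w : Fin h × Fin h → ℝ) (r : ℕ) : Prop :=
  Covers h (2 * (Nat.log 2 h + C) ^ C + 4) gen ∧
  (∀ β : Fin h → Fin (2 * (Nat.log 2 h + C) ^ C + 4), Function.Surjective β →
      ∀ i, BlockConstSymGen β (gen i) → (∃ α : ℝ, gen i = α • Jdir h) ∨ EdgeSignMixed (gen i)) ∧
  (∀ S : Finset (Fin M),
      HasEFOfSize (tangentCone (convexHull ℝ (Set.range (subsetSum gen w))) (subsetSum gen w S)) (r + 1))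

/-- (E5) LAW (statement): every zonotopal enemy meets the spec — (Z1) by `zonoEnemy_covers` below (modulo `ZonoGenBlindAtDecided`),
(Z2) by class K (paper), (Z3) by `ConePricing44.TangentConeEF` (paper). -/
def ZonoResidualLaw : Prop :=
  ∀ (C h M : ℕ) (gen : Fin M → (Fin h × Fin h → ℝ)) (w : Fin h × Fin h → ℝ) (r : ℕ),
    ZonoEnemy C h gen w r → ZonoResidualSpec C h gen w r

/-- (Z1) in kernel modulo the one-cut rung: a budgeted enemy COVERS the reduction level, at every `h` (no threshold). -/
theorem zonoEnemy_covers (hDec : ZonoGenBlindAtDecided) (C h : ℕ) {M : ℕ} (gen : Fin M → (Fin h × Fin h → ℝ))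
    (w : Fin h × Fin h → ℝ) (r : ℕ) (hE : ZonoEnemy C h gen w r) :
    Covers h (2 * (Nat.log 2 h + C) ^ C + 4) gen := by
  by_contra hc
  obtain ⟨_, hr, _, hR⟩ := hE
  exact absurd (lt_of_not_covers hDec C h gen w r hc hR) (not_lt.mpr hr)

/-- sanity: the corona zone `g_{A,B}` with `A = {0}`, `B = {1}` in `Sym_3` is edge-sign-mixed
(`δ_{02}·g = 1 > 0`, `δ_{01}·g = 1 + 0 − 2 = −1 < 0`). -/
example : EdgeSignMixed (h := 3) (fun pq => if (pq.1 = 0 ∧ pq.2 = 0) ∨ (pq.1 = 0 ∧ pq.2 = 1) ∨ (pq.1 = 1 ∧ pq.2 = 0) then 1 else 0) := by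
  refine ⟨⟨0, 2, by decide, ?_⟩, ⟨0, 1, by decide, ?_⟩⟩ <;> simp [cutVal]

end Summit.ValiantsHypothesis.ValiantsHypothesis.Theorems.FifoMatching.FaceBlind

end
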